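import Summits.CriticalPhenomena.PercolationContinuityZ3.Theorems.PercNearOneGluingNoHeavyPcintBFibLevelsLaw
import Summits.CriticalPhenomena.PercolationContinuityZ3.Theorems.PercNearOneGluingNoHeavyPcintUFibBipCheck
import HarnessLib

/-!
# PCINT lane, T-fibre route PHASE 3 (bond), step (7): the tail inequalities of the chain-binomial law, checked over `ℚ`

Cell `prim-pcint`, seat `prim-pcint-1` (gen 13); memo `run/shared/lean/prim/pcint/T-FIBRE-ROUTE.md` (PHASE 3).

The criterion of `BFib.criticalProb_lfib_le_of_table` for the fibre `K_{n,n}` with the breadth-first growth rule of depth `D`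
is a finite family of rational inequalities in the chain-binomial law `lawA p D 0 1 (n-1) n` (`…PcintBFibLevelsLaw.lean`):

  `3473/10⁴ ≤ 1 - (1-p)^{2n}`,   `(Σ_u law u) · P(Bin(k, 3473/10⁴) ≥ j) ≤ Σ_u law u · P(Bin(k, 1-(1-p)^u) ≥ j)`  (`k ≤ 5`, `1 ≤ j ≤ k`).

They are decided by the Boolean program `BFib.checkBond n D p s` (exact rational arithmetic, evaluated by the kernel with
`decide +kernel` in the instance files) through the EXPECTATION form `lawE` of the law (one recursion per test function instead of
one per value, `lawE_eq_sum`), and transported to `ℝ` (`BFib.table_of_checkBond`).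
-/

namespace Summit.CriticalPhenomena.PercolationContinuityZ3.Theorems.Pcint

namespace BFib

open Finset AdaptDom UFib

/-! ### The expectation form of the chain-binomial law -/

/-- **The chain-binomial law as an expectation functional**: `lawE p D acc ℓ rX rY g = Σ_u lawA p D acc ℓ rX rY u · g u`. -/
def lawE {𝕜 : Type*} [Field 𝕜] (p : 𝕜) : ℕ → ℕ → ℕ → ℕ → ℕ → (ℕ → 𝕜) → 𝕜
  | 0, acc, ℓ, _, _, g => g (acc + ℓ)
  | D + 1, acc, ℓ, rX, rY, g => ∑ x ∈ range (rY + 1),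
      (rY.choose x : 𝕜) * (1 - (1 - p) ^ ℓ) ^ x * ((1 - p) ^ ℓ) ^ (rY - x) * lawE p D (acc + ℓ) x (rY - x) rX g

/-- `lawE` is the expectation of `g` under `lawA` (for a range containing the support). -/
theorem lawE_eq_sum {𝕜 : Type*} [Field 𝕜] (p : 𝕜) : ∀ (D acc ℓ rX rY N : ℕ) (g : ℕ → 𝕜),
    acc + ℓ + rX + rY ≤ N → lawE p D acc ℓ rX rY g = ∑ u ∈ range (N + 1), lawA p D acc ℓ rX rY u * g u
  | 0, acc, ℓ, rX, rY, N, g, h => by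
    simp only [lawE, lawA, ite_mul, one_mul, zero_mul]
    rw [Finset.sum_ite_eq' (range (N + 1)) (acc + ℓ) g, if_pos (mem_range.2 (by omega))]
  | D + 1, acc, ℓ, rX, rY, N, g, h => by
    simp only [lawE, lawA]
    rw [Finset.sum_congr rfl fun x hx => by
      rw [lawE_eq_sum p D (acc + ℓ) x (rY - x) rX N g (by have := mem_range.1 hx; omega)]]
    simp_rw [Finset.mul_sum, Finset.sum_mul]
    rw [Finset.sum_comm]
    exact Finset.sum_congr rfl fun u _ => Finset.sum_congr rfl fun x _ => by ring

/-- `lawE` commutes with the cast `ℚ → ℝ`. -/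
theorem lawE_cast (p : ℚ) : ∀ (D acc ℓ rX rY : ℕ) (g : ℕ → ℚ),
    ((lawE p D acc ℓ rX rY g : ℚ) : ℝ) = lawE (p : ℝ) D acc ℓ rX rY (fun u => ((g u : ℚ) : ℝ))
  | 0, acc, ℓ, rX, rY, g => by simp only [lawE]
  | D + 1, acc, ℓ, rX, rY, g => by
    simp only [lawE, Rat.cast_sum, Rat.cast_mul, Rat.cast_pow, Rat.cast_sub, Rat.cast_one, Rat.cast_natCast]
    exact Finset.sum_congr rfl fun x _ => by rw [lawE_cast p D (acc + ℓ) x (rY - x) rX g]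

/-! ### The Boolean check -/

/-- One tail inequality of the bond criterion for `K_{n,n}`, depth `D`, decided over `ℚ`. -/
def bondTailOK (n D k j : ℕ) (p s : ℚ) : Bool :=
  decide (lawE p D 0 1 (n - 1) n (fun _ => 1) * bt k s j ≤ lawE p D 0 1 (n - 1) n (fun u => bt k (1 - (1 - p) ^ u) j))

/-- **The bond criterion check** for `K_{n,n}`, depth `D`, at `(p, s)`: the root inequality `s ≤ 1-(1-p)^{2n}` and the `15`
tail inequalities `k ≤ 5`, `1 ≤ j ≤ k`. -/
def checkBond (n D : ℕ) (p s : ℚ) : Bool :=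
  decide (s ≤ 1 - (1 - p) ^ (2 * n)) &&
    (List.range 6).all fun k => (List.range (k + 1)).all fun j => (j == 0) || bondTailOK n D k j p s

/-- A passed check gives the root inequality and every tail inequality over `ℝ`. -/
theorem table_of_checkBond {n D : ℕ} {p s : ℚ} (h : checkBond n D p s = true) (hn : 1 ≤ n) :
    ((s : ℝ) ≤ 1 - (1 - (p : ℝ)) ^ (2 * n)) ∧
      ∀ k : ℕ, k ≤ 5 → ∀ j, 1 ≤ j → j ≤ k →
        (∑ u ∈ range (2 * n + 1), lawA (p : ℝ) D 0 1 (n - 1) n u) * binTail k (s : ℝ) j ≤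
          ∑ u ∈ range (2 * n + 1), lawA (p : ℝ) D 0 1 (n - 1) n u * binTail k (1 - (1 - (p : ℝ)) ^ u) j := by
  unfold checkBond at h
  rw [Bool.and_eq_true] at h
  obtain ⟨hroot, htail⟩ := h
  refine ⟨?_, fun k hk j hj1 hjk => ?_⟩
  · have := (Rat.cast_le (K := ℝ)).2 (of_decide_eq_true hroot)
    push_cast at this
    exact this
  · have h1 : bondTailOK n D k j p s = true := by
      simp only [List.all_eq_true, List.mem_range] at htail
      have := htail k (by omega) j (by omega)
      rw [Bool.or_eq_true] at this
      rcases this with h0 | h0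
      · have : j = 0 := by simpa using h0
        omega
      · exact h0
    have h2 := (Rat.cast_le (K := ℝ)).2 (of_decide_eq_true h1)
    rw [Rat.cast_mul, lawE_cast, lawE_cast, bt_cast] at h2
    have hN : 0 + 1 + (n - 1) + n ≤ 2 * n := by omega
    rw [lawE_eq_sum (p : ℝ) D 0 1 (n - 1) n (2 * n) _ hN, lawE_eq_sum (p : ℝ) D 0 1 (n - 1) n (2 * n) _ hN] at h2
    simp only [Rat.cast_one, mul_one, bt_cast, Rat.cast_sub, Rat.cast_pow, bt_eq_binTail] at h2
    exact h2

/-- The check from its root inequality and its tails (decided one by one by the kernel when the whole check is too big). -/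
theorem checkBond_of_tails {n D : ℕ} {p s : ℚ} (hroot : decide (s ≤ 1 - (1 - p) ^ (2 * n)) = true)
    (htails : ∀ k : ℕ, k ≤ 5 → ∀ j, 1 ≤ j → j ≤ k → bondTailOK n D k j p s = true) : checkBond n D p s = true := by
  unfold checkBond
  rw [hroot, Bool.true_and]
  simp only [List.all_eq_true, List.mem_range, Bool.or_eq_true]
  intro k hk j hj
  by_cases hj0 : j = 0
  · left; simp [hj0]
  · right; exact htails k (by omega) j (by omega) (by omega)

/-- Sanity check and kernel-cost probe: `K_{2,2}`, depth `4`, `p = 0.2746`, `s = 0.3473` passes. -/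
theorem checkBond_two : checkBond 2 4 (2746 / 10000) (3473 / 10000) = true := by decide +kernel

end BFib

end Summit.CriticalPhenomena.PercolationContinuityZ3.Theorems.Pcint
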